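import Literature.Computability.AlgebraicComplexity.Yab15BRank
import HarnessLib

/-!
# Yabe 2015, Corollary 1.6 from Theorem 1.5 (the `Ω(d^{2k})` bookkeeping) — proof

Topic `Literature/Computability/AlgebraicComplexity`; companion of `Yab15BRank.lean` (A. Yabe,
*Bi-polynomial rank and determinantal complexity*, arXiv:1504.00151, §1, held text p0003).
**Corollary 1.6** ("Let `k ≥ 1` … If there exists a sequence of matrices `X_d ∈ Zeros(perm_d)` …
such that `brank(perm_{d,X_d}^{(2k)}) = Ω(d^{2k})`, then `dc(perm_d) = Ω(d^{2k})`") is, as the source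
says, an immediate consequence of **Theorem 1.5**
(`dc(p) ≥ 2^{-(2k-2)}·brank(p_{x₀}^{(2k)}) − 2(k−1)·D^{k−1}` with `D = d²` variables): for `d` large,
`2(k−1)·d^{2k−2} ≤ (c/2)·d^{2k}/2^{2k-2}`, so `dc(perm_d) ≥ (c/2^{2k−1})·d^{2k}`.

This file proves exactly that implication between the two named facts of `Yab15BRank.lean`:
`yabe2015_cor_1_6_of_thm_1_5 : yabe2015_thm_1_5 → yabe2015_cor_1_6` (Theorem 1.5 instantiated at
the variable type `Fin d × Fin d`, universe `0`). It is CONDITIONAL on `yabe2015_thm_1_5`, which is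
not yet proved in the tree; once `yabe2015_thm_1_5_holds` lands, `yabe2015_cor_1_6_holds` is the
one-line application (to be appended here). No new definitions, no new facts.

## References

* [Yabe2015] A. Yabe, *Bi-polynomial rank and determinantal complexity*, arXiv:1504.00151 (2015),
  Thm. 1.5 and Cor. 1.6 (held text p0003).
-/

noncomputable section

open MvPolynomial

namespace Literature.Computability.AlgebraicComplexity

universe u

/-- **Yabe 2015, Corollary 1.6 from Theorem 1.5** (p0003): if `X_d ∈ Zeros(perm_d)` and
`brank(perm_{d,X_d}^{(2k)}) ≥ c·d^{2k}` for `d ≥ N` (`c > 0`, `k ≥ 1`), then, granting Thm. 1.5,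
`dc(perm_d) ≥ (c/2^{2k−1})·d^{2k}` for all `d ≥ max(N, k, 1, ⌈2^{2k}(k−1)/c⌉)`: Thm. 1.5 at
`p = perm_d` (`D = d²` variables, `k ≤ d ≤ d²`) gives
`c·d^{2k} ≤ 2^{2k−2}·(dc(perm_d) + 2(k−1)·d^{2k−2})`, and `2^{2k}(k−1) ≤ c·d ≤ c·d²` absorbs the
error term into half of the main term. [cite: Yabe2015, Corollary 1.6] -/
theorem yabe2015_cor_1_6_of_thm_1_5 (h15 : yabe2015_thm_1_5.{u, 0}) : yabe2015_cor_1_6.{u} := by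
  intro K _ k hk X hX hbr
  obtain ⟨c, hc, N, hN⟩ := hbr
  obtain ⟨m, rfl⟩ : ∃ m, k = m + 1 := ⟨k - 1, by omega⟩
  -- the threshold beyond which the error term is absorbed
  set M : ℕ := ⌈(2 : ℝ) ^ (2 * m + 2) * m / c⌉₊ with hM
  refine ⟨c / 2 ^ (2 * m + 1), by positivity, max (max N (m + 1)) (max 1 M), fun d hd => ?_⟩
  have hdN : N ≤ d := le_trans (le_trans (le_max_left _ _) (le_max_left _ _)) hd
  have hdk : m + 1 ≤ d := le_trans (le_trans (le_max_right _ _) (le_max_left _ _)) hd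
  have hd1 : 1 ≤ d := le_trans (le_trans (le_max_left _ _) (le_max_right _ _)) hd
  have hdM : M ≤ d := le_trans (le_trans (le_max_right _ _) (le_max_right _ _)) hd
  -- Theorem 1.5 for `perm_d` at the zero `X d`, `k = m + 1 ≤ d²`
  have hcard : m + 1 ≤ Fintype.card (Fin d × Fin d) := by
    rw [Fintype.card_prod, Fintype.card_fin]
    nlinarith
  have h := h15 K (Fin d × Fin d) (perPoly (Fin d) K) (m + 1) (X d) (by omega) hcard (hX d hd1)
  have e_exp : 2 * (m + 1) - 2 = 2 * m := by omega
  rw [e_exp, Nat.add_sub_cancel, Fintype.card_prod, Fintype.card_fin] at h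
  -- pass to `ℝ`
  set b : ℕ := bRank (m + 1) (homogeneousComponent (2 * (m + 1)) (transl (X d) (perPoly (Fin d) K)))
    with hb
  set δ : ℕ := determinantalComplexity (perPoly (Fin d) K) with hδ
  have hbN : c * (d : ℝ) ^ (2 * (m + 1)) ≤ b := hN d hdN
  have h' : (b : ℝ) ≤ (2 : ℝ) ^ (2 * m) * ((δ : ℝ) + 2 * m * ((d : ℝ) * d) ^ m) := by
    exact_mod_cast h
  set D : ℝ := (d : ℝ) with hD
  set P : ℝ := D ^ (2 * m) with hP
  set Q : ℝ := (2 : ℝ) ^ (2 * m) with hQ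
  have hD1 : (1 : ℝ) ≤ D := by rw [hD]; exact_mod_cast hd1
  have hP0 : 0 ≤ P := by rw [hP]; positivity
  have hQ0 : 0 < Q := by rw [hQ]; positivity
  have hpow : D ^ (2 * (m + 1)) = P * D ^ 2 := by
    rw [hP, show 2 * (m + 1) = 2 * m + 2 by ring, pow_add]
  have hsq : (D * D) ^ m = P := by
    rw [hP, ← sq, ← pow_mul]
  rw [hpow] at hbN
  rw [hsq] at h'
  -- the main inequality: `c·P·D² ≤ Q·δ + Q·2m·P`
  have s1 : c * (P * D ^ 2) ≤ Q * δ + Q * (2 * m) * P := by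
    have := hbN.trans h'
    linarith [this]
  -- the threshold: `2^{2m+2}·m ≤ c·D ≤ c·D²`
  have hthr : (2 : ℝ) ^ (2 * m + 2) * m ≤ c * D ^ 2 := by
    have h1 : (2 : ℝ) ^ (2 * m + 2) * m / c ≤ M := Nat.le_ceil _
    have h2 : (M : ℝ) ≤ D := by rw [hD]; exact_mod_cast hdM
    have h3 : (2 : ℝ) ^ (2 * m + 2) * m ≤ c * D := by
      have := (div_le_iff₀ hc).mp (h1.trans h2)
      linarith
    have hDD : D ≤ D ^ 2 := by
      have := mul_le_mul_of_nonneg_left hD1 (zero_le_one.trans hD1)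
      nlinarith [this]
    have h4 : c * D ≤ c * D ^ 2 := mul_le_mul_of_nonneg_left hDD hc.le
    exact h3.trans h4
  -- absorb the error term: `Q·2m·P ≤ (c/2)·P·D²`
  have s2 : Q * (2 * m) * P ≤ c * (P * D ^ 2) / 2 := by
    have h5 := mul_le_mul_of_nonneg_left hthr hP0
    have e1 : Q * (2 * m) * P = P * ((2 : ℝ) ^ (2 * m + 2) * m) / 2 := by
      rw [hQ]; ring
    have e2 : c * (P * D ^ 2) / 2 = P * (c * D ^ 2) / 2 := by ring
    rw [e1, e2]
    linarith
  -- conclude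
  show c / 2 ^ (2 * m + 1) * D ^ (2 * (m + 1)) ≤ (δ : ℝ)
  rw [hpow, div_mul_eq_mul_div, div_le_iff₀ (by positivity)]
  have e3 : (δ : ℝ) * 2 ^ (2 * m + 1) = 2 * (Q * δ) := by rw [hQ]; ring
  rw [e3]
  linarith [s1, s2]

end Literature.Computability.AlgebraicComplexity

end
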